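import Literature.NumberTheory.LFunctions.GoldfeldSchinzelLowerHalfExplicit
import Literature.NumberTheory.QuadraticFields.SquareRootsModuloCount
import Literature.NumberTheory.LFunctions.PrimitiveQuadraticCharacterKronecker
import Literature.NumberTheory.DiophantineGeometry.SquarefulSumsCountingTools
import HarnessLib

/-!
# The `h/log²h` shape of the class-summed repulsion, explicit for EVERY class number:
# `Σ_Q 1/a_Q ≤ h/(N+1) + 2(1 + log N)²` and `h(−d) < (1−β)(1+5(1−β))·(π/6)√d·(1 + 2(1 + log h)²)`

Topic `Literature/NumberTheory/LFunctions` (namespace `Literature.NumberTheory.LFunctions`, sub-namespace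
`ClassSumRepulsion`). Everything in this file is PROVED (theorems only; no definition, no named fact, debt 0).
Cell `parity-realchar` (SIEGEL INSTRUMENT): TARGET §2 row 16 ODD v5 / conditionals topics I.1, I.17 — an explicit
form, valid for every `h(−d)`, of Ralaivaosaona–Razakarinoro's Theorem 2 (`1 − β > (2π + o(1))h/((log h)²√d)`
as `h → ∞`; "It is also possible to obtain an explicit bound for the `o(1)` term … not very useful unless we
have an explicit lower bound for the class number", p. 797).

* `card_fiber_le_two_mul_card_divisors` — at most `2τ(n)` reduced forms of a fundamental discriminant `D < 0`
  have leading coefficient `n` (`SquareRootsModuloCount.card_Ioc_roots_le_two_mul_card_divisors` with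
  `ReducedFormsLeadingCoefficients.card_filter_fst_eq_le`);
* `sum_inv_fst_le_log` — **`Σ_{Q reduced} 1/a_Q ≤ h(D)/(N+1) + 2(1 + log N)²` for every `N ≥ 1`**
  (rearrangement, `Σ_{n ≤ N} τ(n)/n ≤ (1 + log N)²` — tree `SquarefulCount.sum_card_divisors_div_le`);
* `classNumber_lt_log_form` — at every real zero `β ∈ [9/10, 1)` of `L(s, χ)`, `χ` the odd real primitive
  character mod `d > 4` (so `−d` is fundamental, tree `isFundamentalDiscriminant_neg`):
  **`h(−d) < (1−β)(1 + 5(1−β))·(π/6)√d·(1 + 2(1 + log h(−d))²)`**, i.e.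
  **`1 − β > (6/π)·h/((1 + 2(1 + log h)²)·√d)·(1 + 5(1−β))⁻¹`**, `h = h(−d)`; parametric form
  `classNumber_lt_log_param` (every `N ≥ 1`); field side `…_field`.

Constants: `6/π` with `τ` in place of the sharper `2π` with `2^ω`-density of the printed asymptotic, but uniform in
`h` and `d`. For `h ≥ 101` the table file gives the better `18/√d`; the present shape is what grows with `h`
(beyond `√h`, `RealZeroRepulsionOddSqrtClassNumber.lean`) and is the form to combine with effective class-number
lower bounds (Goldfeld–Gross–Zagier–Oesterlé `h(−d) ≫ log d` — tree named fact `Oesterle1985_theoreme1`, not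
invoked here).

LABEL (cell rule): row 16 / I.1 / I.17 kernel, hypothesis-free. WHAT THIS IS NOT: not the asymptotic constant
`2π`; nothing for even characters; nothing here bears on parity (H5).

## References

* [RalaivaosaonaRazakarinoro2026] Theorem 2 (p. 797), Lemma 1, Lemma 2.
* [GoldfeldSchinzel1975] Theorem 1 (case `d < 0`).
* [Apostol1976] Thm 5.28 (the root counts).
-/

noncomputable section

open Complex Finset
open Literature.NumberTheory.QuadraticFields Literature.NumberTheory.QuadraticFields.Quadratic
open Literature.NumberTheory.QuadraticFields.BinaryQuadraticForm (reducedForms mem_reducedForms_iff)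
open Literature.NumberTheory.LFunctions.PrimitiveQuadratic (isFundamentalDiscriminant_neg)
open Literature.NumberTheory.DiophantineGeometry (SquarefulCount.sum_card_divisors_div_le)

namespace Literature.NumberTheory.LFunctions

namespace ClassSumRepulsion

/-! ### The `log²` census -/

/-- **At most `2τ(n)` reduced forms of a fundamental discriminant `D < 0` have leading coefficient `n = k + 1`.**
[cite: RalaivaosaonaRazakarinoro2026, Lemma 1] [cite: Cox2013, §2.A eq. (2.7)] -/
theorem card_fiber_le_two_mul_card_divisors {D : ℤ} (hD0 : D < 0)
    (hD : (D % 4 = 1 ∧ Squarefree D) ∨ (4 ∣ D ∧ (D / 4 % 4 = 2 ∨ D / 4 % 4 = 3) ∧ Squarefree (D / 4)))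
    (k : ℕ) :
    ((reducedForms D).filter (fun Q => Q.1 = (k : ℤ) + 1)).card ≤ 2 * (k + 1).divisors.card := by
  have h1 := BinaryQuadraticForm.LeadingCoeff.card_filter_fst_eq_le hD0 ((k : ℤ) + 1)
  have h2 := SqrtModCount.card_Ioc_roots_le_two_mul_card_divisors hD (n := k + 1) (Nat.succ_pos k)
  have e : (((k + 1 : ℕ) : ℤ)) = (k : ℤ) + 1 := by push_cast; ring
  rw [e] at h2
  exact h1.trans h2

/-- **`Σ_{Q ∈ reducedForms D} 1/a_Q ≤ h(D)/(N+1) + 2(1 + log N)²`** for every fundamental `D < 0` and `N ≥ 1`.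
[cite: RalaivaosaonaRazakarinoro2026, Lemma 2] -/
theorem sum_inv_fst_le_log {D : ℤ} (hD0 : D < 0)
    (hD : (D % 4 = 1 ∧ Squarefree D) ∨ (4 ∣ D ∧ (D / 4 % 4 = 2 ∨ D / 4 % 4 = 3) ∧ Squarefree (D / 4)))
    {N : ℕ} (hN : 1 ≤ N) :
    ∑ Q ∈ reducedForms D, (1 : ℝ) / (Q.1 : ℝ) ≤
      (BinaryQuadraticForm.classNumber D : ℝ) / ((N : ℝ) + 1) + 2 * (1 + Real.log N) ^ 2 := by
  have ha : ∀ Q ∈ reducedForms D, (1 : ℤ) ≤ Q.1 := fun Q hQ => by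
    obtain ⟨-, ha, -, -⟩ := (mem_reducedForms_iff hD0).1 hQ; omega
  have h := BinaryQuadraticForm.LeadingCoeff.sum_one_div_le_of_card_fiber_le (reducedForms D) (fun Q => Q.1)
    ha N (fun k => 2 * (k + 1).divisors.card) (fun k _ => card_fiber_le_two_mul_card_divisors hD0 hD k)
  have hc : ((reducedForms D).card : ℝ) = (BinaryQuadraticForm.classNumber D : ℝ) := rfl
  rw [hc] at h
  refine h.trans (add_le_add le_rfl ?_)
  -- `Σ_{k<N} 2τ(k+1)(1/(k+1) − 1/(N+1)) ≤ 2 Σ_{k<N} τ(k+1)/(k+1) = 2 Σ_{n ≤ N} τ(n)/n ≤ 2(1 + log N)²`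
  have hstep : ∑ k ∈ Finset.range N, ((2 * (k + 1).divisors.card : ℕ) : ℝ) *
      (1 / ((k : ℝ) + 1) - 1 / ((N : ℝ) + 1)) ≤
      2 * ∑ k ∈ Finset.range N, (((k + 1).divisors.card : ℕ) : ℝ) * (((k + 1 : ℕ) : ℝ))⁻¹ := by
    rw [Finset.mul_sum]
    refine Finset.sum_le_sum fun k _ => ?_
    have hpos : (0 : ℝ) ≤ (((k + 1).divisors.card : ℕ) : ℝ) := by positivity
    have hN1 : (0 : ℝ) < 1 / ((N : ℝ) + 1) := by positivity
    have e : (((k + 1 : ℕ) : ℝ))⁻¹ = 1 / ((k : ℝ) + 1) := by push_cast; rw [one_div]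
    rw [e]
    push_cast
    nlinarith
  have hshift : ∑ k ∈ Finset.range N, (((k + 1).divisors.card : ℕ) : ℝ) * (((k + 1 : ℕ) : ℝ))⁻¹ =
      ∑ n ∈ Finset.Icc 1 N, ((n.divisors.card : ℕ) : ℝ) * ((n : ℕ) : ℝ)⁻¹ := by
    rw [Finset.range_eq_Ico, Finset.sum_Ico_add' (fun n : ℕ => ((n.divisors.card : ℕ) : ℝ) * ((n : ℕ) : ℝ)⁻¹) 0 N 1,
      zero_add, Finset.Ico_add_one_right_eq_Icc]
  have hdiv := SquarefulCount.sum_card_divisors_div_le N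
  rw [hshift] at hstep
  linarith

/-! ### At a real zero -/

/-- `−d` is a fundamental discriminant in the shape used by `SquareRootsModuloCount` (for the conductor of an
odd real primitive character). [cite: MontgomeryVaughan2007, Theorem 9.13] -/
private theorem fundamental_neg {d : ℕ} [NeZero d] {χ : DirichletCharacter ℂ d}
    (hprim : χ.IsPrimitive) (hquad : χ.IsQuadratic) (hodd : χ.Odd) :
    ((-(d : ℤ)) % 4 = 1 ∧ Squarefree (-(d : ℤ))) ∨
      (4 ∣ (-(d : ℤ)) ∧ ((-(d : ℤ)) / 4 % 4 = 2 ∨ (-(d : ℤ)) / 4 % 4 = 3) ∧ Squarefree ((-(d : ℤ)) / 4)) := by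
  rcases isFundamentalDiscriminant_neg hprim hquad hodd with ⟨h1, h2, -⟩ | ⟨h1, h2, h3⟩
  · exact Or.inl ⟨h1, h2⟩
  · exact Or.inr ⟨h1, h2, h3⟩

/-- **Parametric `log²` form at a real zero**: for the odd real primitive `χ` mod `d > 4`, every real zero
`β ∈ [9/10, 1)` of `L(s, χ)` and every `N ≥ 1`:
`h(−d) < (1−β)(1+5(1−β))(π/6)√d · (h(−d)/(N+1) + 2(1 + log N)²)`.
[cite: GoldfeldSchinzel1975, Theorem 1 (case d < 0)] [cite: RalaivaosaonaRazakarinoro2026, Theorem 2] -/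
theorem classNumber_lt_log_param {d : ℕ} [NeZero d] (hd : 4 < d)
    {χ : DirichletCharacter ℂ d} (hprim : χ.IsPrimitive) (hquad : χ.IsQuadratic) (hodd : χ.Odd)
    {β : ℝ} (hβ9 : 9 / 10 ≤ β) (hβ1 : β < 1) (hz : χ.LFunction β = 0) {N : ℕ} (hN : 1 ≤ N) :
    (BinaryQuadraticForm.classNumber (-(d : ℤ)) : ℝ) <
      (1 - β) * (1 + 5 * (1 - β)) * (Real.pi / 6) * Real.sqrt d *
        ((BinaryQuadraticForm.classNumber (-(d : ℤ)) : ℝ) / ((N : ℝ) + 1) + 2 * (1 + Real.log N) ^ 2) := by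
  have hD0 : (-(d : ℤ)) < 0 := by omega
  have hmain := one_sub_realZero_mul_sum_gt_classNumber hd hprim hquad hodd hβ9 hβ1 hz
  have hS := sum_inv_fst_le_log hD0 (fundamental_neg hprim hquad hodd) hN
  have hδ0 : 0 < 1 - β := by linarith
  have hd4R : (4 : ℝ) < d := by exact_mod_cast hd
  have hsd0 : 0 < Real.sqrt d := Real.sqrt_pos.2 (by linarith)
  have hA : 0 ≤ (1 - β) * (1 + 5 * (1 - β)) * (Real.pi / 6) * Real.sqrt d := by
    have := Real.pi_pos; positivity
  have := mul_le_mul_of_nonneg_left hS hA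
  nlinarith

/-- **The explicit `h/log²h` repulsion, every class number**: for the odd real primitive `χ` mod `d > 4` and every
real zero `β ∈ [9/10, 1)` of `L(s, χ)`, with `h = h(−d)`:
`h < (1−β)(1+5(1−β))·(π/6)·√d·(1 + 2(1 + log h)²)`, i.e.
`1 − β > (6/π)·h/((1 + 2(1 + log h)²)√d)·(1 + 5(1−β))⁻¹` (take `N = h`: `h/(h+1) < 1`).
[cite: RalaivaosaonaRazakarinoro2026, Theorem 2] [cite: GoldfeldSchinzel1975, Theorem 1 (case d < 0)] -/
theorem classNumber_lt_log_form {d : ℕ} [NeZero d] (hd : 4 < d)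
    {χ : DirichletCharacter ℂ d} (hprim : χ.IsPrimitive) (hquad : χ.IsQuadratic) (hodd : χ.Odd)
    {β : ℝ} (hβ9 : 9 / 10 ≤ β) (hβ1 : β < 1) (hz : χ.LFunction β = 0) :
    (BinaryQuadraticForm.classNumber (-(d : ℤ)) : ℝ) <
      (1 - β) * (1 + 5 * (1 - β)) * (Real.pi / 6) * Real.sqrt d *
        (1 + 2 * (1 + Real.log (BinaryQuadraticForm.classNumber (-(d : ℤ)))) ^ 2) := by
  set h : ℕ := BinaryQuadraticForm.classNumber (-(d : ℤ)) with hh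
  have hD0 : (-(d : ℤ)) < 0 := by omega
  -- `h ≥ 1`
  have hpos : 0 < h := by
    rw [hh]
    refine BinaryQuadraticForm.classNumber_pos hD0 ?_
    rcases isFundamentalDiscriminant_neg hprim hquad hodd with ⟨h1, -, -⟩ | ⟨h0, -, -⟩
    · exact Or.inr h1
    · exact Or.inl (Int.emod_eq_zero_of_dvd h0)
  have hmain := classNumber_lt_log_param hd hprim hquad hodd hβ9 hβ1 hz (N := h) hpos
  rw [← hh] at hmain
  have hδ0 : 0 < 1 - β := by linarith
  have hd4R : (4 : ℝ) < d := by exact_mod_cast hd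
  have hsd0 : 0 < Real.sqrt d := Real.sqrt_pos.2 (by linarith)
  have hA : 0 < (1 - β) * (1 + 5 * (1 - β)) * (Real.pi / 6) * Real.sqrt d := by
    have := Real.pi_pos; positivity
  have hfrac : (h : ℝ) / ((h : ℝ) + 1) < 1 := by
    rw [div_lt_one (by positivity)]; linarith
  have := mul_lt_mul_of_pos_left (add_lt_add_right hfrac (2 * (1 + Real.log h) ^ 2)) hA
  linarith

variable {K : Type*} [Field K] [NumberField K]

/-- **Field side: `h_K < (1−β)(1+5(1−β))·(π/6)·√|d_K|·(1 + 2(1 + log h_K)²)`** for the imaginary quadratic field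
`K` with `d_K = −d` (`d > 4`) and every real zero `β ∈ [9/10, 1)` of its Kronecker character's `L`-function.
[cite: RalaivaosaonaRazakarinoro2026, Theorem 2] [cite: Cox2013, §7.B Thm. 7.7(ii)] -/
theorem classNumber_lt_log_form_field (h2 : Module.finrank ℚ K = 2) {d : ℕ} [NeZero d]
    (hdK : NumberField.discr K = -(d : ℤ)) (hd : 4 < d) {χ : DirichletCharacter ℂ d}
    (hprim : χ.IsPrimitive) (hquad : χ.IsQuadratic) (hodd : χ.Odd)
    {β : ℝ} (hβ9 : 9 / 10 ≤ β) (hβ1 : β < 1) (hz : χ.LFunction β = 0) :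
    (NumberField.classNumber K : ℝ) <
      (1 - β) * (1 + 5 * (1 - β)) * (Real.pi / 6) * Real.sqrt d *
        (1 + 2 * (1 + Real.log (NumberField.classNumber K)) ^ 2) := by
  have hdneg : NumberField.discr K < 0 := by rw [hdK]; omega
  have hcard := card_reducedForms_eq_classNumber h2 hdneg
  rw [hdK] at hcard
  have := classNumber_lt_log_form hd hprim hquad hodd hβ9 hβ1 hz
  rw [hcard] at this
  exact this

end ClassSumRepulsion

end Literature.NumberTheory.LFunctions
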